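import Summits.QuantumAdvantage.QuantumAdvantage.Theorems.TallyDialAA

/-! # TallyDialA — part 2/2 (mechanical split for landing of `TallyDialA`; content verbatim; scopes re-opened with their variables) -/

set_option linter.dupNamespace false
set_option autoImplicit false
open Finset
open Literature.Computability.MetaComplexity Literature.Computability.MetaComplexity.Smolensky
open Literature.Computability.Complexity (parityFn)
open Summit.QuantumAdvantage.AdviceFreeQNC0

namespace Summit.QuantumAdvantage.QuantumAdvantage.Theorems.TallyDial
variable {n : ℕ}

/-- the shot parity of a XOR family is the parity of the lit members. -/
theorem shotParity_xorFam {ι : Type*} [DecidableEq ι] (s : Finset ι)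
    (F : ι → Fin (n + 1) → (Fin n → Bool) → Bool) (u : Fin n → Bool) :
    shotParity (xorFam s F) u = decide ((s.filter fun i => shotParity (F i) u = true).card % 2 = 1) := by
  induction s using Finset.induction_on with
  | empty =>
    rw [xorFam_empty]
    simp [shotParity, tally]
  | insert a s ha ih =>
    rw [xorFam_insert ha, shotParity_xorStrat, ih, filter_insert]
    cases h : shotParity (F a) u
    · simp
    · rw [if_pos rfl, card_insert_of_notMem (fun hm => ha (mem_filter.mp hm).1)]
      rcases Nat.mod_two_eq_zero_or_one ((s.filter fun i => shotParity (F i) u = true).card) with hk | hk <;>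
        simp [Nat.add_mod, hk]

/-- cutwise degree of a XOR family whose members fire the cut `g` for at most ONE index `i₀`:
that cut of the family IS the cut of member `i₀`. -/
theorem xorFam_apply_of_unique {ι : Type*} [DecidableEq ι] (s : Finset ι)
    (F : ι → Fin (n + 1) → (Fin n → Bool) → Bool) (g : Fin (n + 1)) (i₀ : ι) (hi₀ : i₀ ∈ s)
    (huniq : ∀ i ∈ s, ∀ u, F i g u = true → i = i₀) (u : Fin n → Bool) :
    xorFam s F g u = F i₀ g u := by
  unfold xorFam
  cases h : F i₀ g u
  · have : (s.filter fun i => F i g u = true) = ∅ := by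
      ext i
      simp only [mem_filter, Finset.notMem_empty, iff_false, not_and]
      intro hi hF
      have := huniq i hi u hF
      rw [this, h] at hF
      exact Bool.false_ne_true hF
    rw [this]
    simp
  · have : (s.filter fun i => F i g u = true) = {i₀} := by
      ext i
      simp only [mem_filter, mem_singleton]
      constructor
      · exact fun hh => huniq i hh.1 u hh.2
      · intro hi
        rw [hi]
        exact ⟨hi₀, h⟩
    rw [this, card_singleton]
    decide

/-- if NO member fires the cut `g`, the family's cut `g` is silent. -/
theorem xorFam_apply_of_none {ι : Type*} [DecidableEq ι] (s : Finset ι)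
    (F : ι → Fin (n + 1) → (Fin n → Bool) → Bool) (g : Fin (n + 1))
    (hnone : ∀ i ∈ s, ∀ u, F i g u = false) (u : Fin n → Bool) :
    xorFam s F g u = false := by
  unfold xorFam
  have : (s.filter fun i => F i g u = true) = ∅ := by
    ext i
    simp only [mem_filter, Finset.notMem_empty, iff_false, not_and]
    intro hi hF
    rw [hnone i hi u] at hF
    exact Bool.false_ne_true hF
  rw [this]
  simp

/-- **THE NULL COMB**: the XOR over all blocks `b < ⌊(n+1)/3⌋` of the window triples at `a = 3b`. -/
def comb (n : ℕ) : Fin (n + 1) → (Fin n → Bool) → Bool :=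
  xorFam (univ : Finset (Fin (blocks n))) fun b => tripleAt (3 * b.val)

/-- the comb is EXACTLY NULL at every charge. -/
theorem ringWinU_comb (c : ℕ) (u : Fin n → Bool) : ringWinU c (comb n) u = false := by
  unfold comb
  refine ringWinU_xorFam_null c (univ : Finset (Fin (blocks n))) (fun b => tripleAt (3 * b.val))
    (fun b _ v => ?_) u
  show ringWinU c (tripleAt (3 * b.val)) v = false
  unfold tripleAt
  by_cases h : 3 * b.val + 2 ≤ n
  · have : (fun g w => if h' : 3 * b.val + 2 ≤ n then triple (3 * b.val) h' g w else false) = triple (3 * b.val) h := by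
      funext g w
      rw [dif_pos h]
    rw [this]
    exact ringWinU_triple c _ h v
  · exact absurd (three_mul_add_two_le b.isLt) h

/-- the comb's cut `g` is the cut `g` of the triple of block `⌊g/3⌋` (or silent): cut degree `2`. -/
theorem hasDegF_comb {p : ℕ} [Fact p.Prime] (g : Fin (n + 1)) : HasDegF p (comb n g) 2 := by
  unfold comb
  by_cases hg : g.val / 3 < blocks n
  · -- only block `⌊g/3⌋` can fire `g`
    have heq : (fun u => xorFam (univ : Finset (Fin (blocks n))) (fun b => tripleAt (3 * b.val)) g u) =
        fun u => tripleAt (3 * (g.val / 3)) g u := by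
      funext u
      exact xorFam_apply_of_unique (univ : Finset (Fin (blocks n))) (fun b => tripleAt (3 * b.val)) g
        ⟨g.val / 3, hg⟩ (mem_univ _) (fun b _ v hb => by
        change tripleAt (3 * b.val) g v = true at hb
        unfold tripleAt at hb
        by_cases h' : 3 * b.val + 2 ≤ n
        · rw [dif_pos h'] at hb
          simp only [triple, Bool.and_eq_true, decide_eq_true_eq] at hb
          apply Fin.ext
          show b.val = g.val / 3
          omega
        · rw [dif_neg h'] at hb
          exact absurd hb Bool.false_ne_true) u
    rw [show xorFam (univ : Finset (Fin (blocks n))) (fun b => tripleAt (3 * b.val)) g =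
      fun u => xorFam (univ : Finset (Fin (blocks n))) (fun b => tripleAt (3 * b.val)) g u from rfl, heq]
    unfold tripleAt
    have h3 : 3 * (g.val / 3) + 2 ≤ n := three_mul_add_two_le hg
    simp only [dif_pos h3]
    exact hasDegF_triple _ h3 g
  · -- no block fires `g`
    have heq : (fun u => xorFam (univ : Finset (Fin (blocks n))) (fun b => tripleAt (3 * b.val)) g u) =
        fun _ => false := by
      funext u
      refine xorFam_apply_of_none (univ : Finset (Fin (blocks n))) (fun b => tripleAt (3 * b.val)) g
        (fun b _ v => ?_) u
      unfold tripleAt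
      by_cases h' : 3 * b.val + 2 ≤ n
      · rw [dif_pos h']
        have hb := b.isLt
        simp only [triple, Bool.and_eq_false_imp, decide_eq_true_eq]
        intro hr
        exfalso
        apply hg
        have : b.val = g.val / 3 := by omega
        omega
      · rw [dif_neg h']
    rw [show xorFam (univ : Finset (Fin (blocks n))) (fun b => tripleAt (3 * b.val)) g =
      fun u => xorFam (univ : Finset (Fin (blocks n))) (fun b => tripleAt (3 * b.val)) g u from rfl, heq]
    exact RigidityLaws.hasDegF_const p false 2

/-- the comb's shot parity = parity of the number of lit blocks. -/
theorem shotParity_comb (u : Fin n → Bool) :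
    shotParity (comb n) u =
      decide (((univ : Finset (Fin (blocks n))).filter fun b =>
        twin (3 * b.val) (three_mul_add_two_le b.isLt) u = true).card % 2 = 1) := by
  unfold comb
  rw [shotParity_xorFam]
  have hfil : ((univ : Finset (Fin (blocks n))).filter fun b => shotParity (tripleAt (3 * b.val)) u = true) =
      (univ : Finset (Fin (blocks n))).filter fun b => twin (3 * b.val) (three_mul_add_two_le b.isLt) u = true := by
    apply Finset.filter_congr
    intro b _
    unfold tripleAt
    have h : 3 * b.val + 2 ≤ n := three_mul_add_two_le b.isLt
    have : (fun g w => if h' : 3 * b.val + 2 ≤ n then triple (3 * b.val) h' g w else false) = triple (3 * b.val) h := by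
      funext g w
      rw [dif_pos h]
    rw [this, shotParity_triple]
  rw [hfil]

/-- the LITERAL SUBSTITUTION `v ↦ u`: bit `3b ↦ v_b`, bit `3b+1 ↦ 1`, every other bit `↦ 0`. -/
def sub (n : ℕ) (v : Fin (blocks n) → Bool) (j : Fin n) : Bool :=
  if h : j.val % 3 = 0 ∧ j.val / 3 < blocks n then v ⟨j.val / 3, h.2⟩ else decide (j.val % 3 = 1)

/-- under the substitution, block `b` is lit iff `v_b`. -/
theorem twin_sub (v : Fin (blocks n) → Bool) (b : Fin (blocks n)) :
    twin (3 * b.val) (three_mul_add_two_le b.isLt) (sub n v) = v b := by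
  unfold twin sub
  have hb := three_mul_add_two_le b.isLt
  have e1 : (3 * b.val) % 3 = 0 := by omega
  have e2 : (3 * b.val) / 3 = b.val := by omega
  have e4 : (3 * b.val + 1) % 3 = 1 := by omega
  simp [e1, e2, e4, b.isLt]

/-- **the comb's shot parity restricts to PARITY**: `μ_comb ∘ sub = PARITY_m`, `m = ⌊(n+1)/3⌋`. -/
theorem shotParity_comb_sub (v : Fin (blocks n) → Bool) :
    shotParity (comb n) (sub n v) = parityFn (blocks n) v := by
  rw [shotParity_comb]
  unfold parityFn Literature.Computability.Complexity.GateFn.numOnes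
  have hfil : ((univ : Finset (Fin (blocks n))).filter fun b =>
      twin (3 * b.val) (three_mul_add_two_le b.isLt) (sub n v) = true) =
      (univ : Finset (Fin (blocks n))).filter fun b => v b = true := by
    apply Finset.filter_congr
    intro b _
    rw [twin_sub]
  rw [hfil]

/-- each coordinate of the substitution is a literal or a constant: degree `≤ 1`. -/
theorem sub_coord_mem_lowDeg (p : ℕ) [Fact p.Prime] (j : Fin n) :
    (fun v : Fin (blocks n) → Bool => if sub n v j = true then (1 : ZMod p) else 0) ∈
      lowDeg (ZMod p) (blocks n) 1 := by
  unfold sub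
  by_cases h : j.val % 3 = 0 ∧ j.val / 3 < blocks n
  · simp only [h, and_self, dif_pos]
    exact bitFn_mem_lowDeg _ le_rfl
  · simp only [h, dif_neg, not_false_eq_true, decide_eq_true_eq]
    by_cases h1 : j.val % 3 = 1
    · simp only [h1, if_true]
      have := RigidityLaws.hasDegF_const p true 1 (n := blocks n)
      unfold HasDegF at this
      simpa using this
    · simp only [h1, if_false]
      exact Submodule.zero_mem _

/-- **PARITY HAS NO LOW 𝔽_p-DEGREE** (`p ≠ 2`): `16(d+1)² ≤ m ⟹ ¬ HasDegF p PARITY_m d`.  From the tree's relative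
Smolensky inequality `PairFreezing.relBal_three_of_sq_le` applied to `f = PARITY_m` itself: its even part is empty,
its odd part is not. -/
theorem parity_not_hasDegF {p : ℕ} [Fact p.Prime] (hp2 : p ≠ 2) {m d : ℕ} (hm : 16 * (d + 1) ^ 2 ≤ m) :
    ¬ HasDegF p (parityFn m) d := by
  intro h
  have hbal := Theorems.PairFreezing.relBal_three_of_sq_le hp2 h hm
  have hE : Theorems.PairFreezing.evenPart (parityFn m) = ∅ := by
    ext z
    simp [Theorems.PairFreezing.evenPart]
  have hm1 : 1 ≤ m := le_trans (by nlinarith [Nat.zero_le d]) hm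
  have hO : (fun i : Fin m => decide (i.val = 0)) ∈ Theorems.PairFreezing.oddPart (parityFn m) := by
    have hpar : parityFn m (fun i : Fin m => decide (i.val = 0)) = true := by
      unfold parityFn Literature.Computability.Complexity.GateFn.numOnes
      have : (univ.filter fun i : Fin m => decide (i.val = 0) = true) = {⟨0, hm1⟩} := by
        ext i
        simp [Fin.ext_iff]
      rw [this, card_singleton]
      decide
    unfold Theorems.PairFreezing.oddPart
    rw [mem_filter]
    exact ⟨mem_univ _, hpar, hpar⟩
  have hpos := Finset.card_pos.mpr ⟨_, hO⟩
  unfold Theorems.PairFreezing.RelBal at hbal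
  rw [hE, card_empty, mul_zero] at hbal
  omega

/-! ## §5 THE COLLAPSE: the wild piece is T -/

/-- degree budget: `L^C + 2 ≤ L^{C+2}` for `L ≥ 2`. -/
theorem pow_add_two_le {L C : ℕ} (hL : 2 ≤ L) : L ^ C + 2 ≤ L ^ (C + 2) := by
  have h1 : 1 ≤ L ^ C := Nat.one_le_pow _ _ (by omega)
  have h4 : 4 ≤ L ^ 2 := by nlinarith
  rw [pow_add]
  nlinarith

/-- size budget: for large `n`, `16((log₂ n)^{C'} + (log₂ n)^{C''} + 1)² ≤ ⌊(n+1)/3⌋`. -/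
theorem budget (C' C'' : ℕ) : ∃ N : ℕ, ∀ n ≥ N,
    16 * ((Nat.log 2 n) ^ C' + (Nat.log 2 n) ^ C'' + 1) ^ 2 ≤ blocks n := by
  obtain ⟨n₂, hn₂⟩ := TubePlanProof.logPow_le_natSqrt (C' + C'' + 5)
  refine ⟨max n₂ 4, fun n hn => ?_⟩
  have hn2 : n₂ ≤ n := le_trans (le_max_left _ _) hn
  have hn4 : 4 ≤ n := le_trans (le_max_right _ _) hn
  set L := Nat.log 2 n with hL
  have hL2 : 2 ≤ L := by
    rw [hL]
    exact Nat.le_log_of_pow_le (by norm_num) (by omega)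
  have hL1 : 1 ≤ L := by omega
  have hA : L ^ C' ≤ L ^ (C' + C'') := Nat.pow_le_pow_right hL1 (by omega)
  have hB : L ^ C'' ≤ L ^ (C' + C'') := Nat.pow_le_pow_right hL1 (by omega)
  have h1 : 1 ≤ L ^ (C' + C'') := Nat.one_le_pow _ _ hL1
  have hsum : L ^ C' + L ^ C'' + 1 ≤ 3 * L ^ (C' + C'') := by omega
  have h3 : 3 * L ^ (C' + C'') ≤ L ^ (C' + C'' + 2) := by
    have h4 : 4 ≤ L ^ 2 := by nlinarith
    have e : L ^ (C' + C'' + 2) = L ^ (C' + C'') * L ^ 2 := by ring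
    rw [e]
    nlinarith
  have h48 : 48 ≤ L ^ 6 := le_trans (by norm_num : 48 ≤ 2 ^ 6) (Nat.pow_le_pow_left hL2 6)
  have hsq : (L ^ C' + L ^ C'' + 1) ^ 2 ≤ (L ^ (C' + C'' + 2)) ^ 2 := Nat.pow_le_pow_left (hsum.trans h3) 2
  have hmain : 48 * (L ^ C' + L ^ C'' + 1) ^ 2 ≤ (L ^ (C' + C'' + 5)) ^ 2 := by
    calc 48 * (L ^ C' + L ^ C'' + 1) ^ 2 ≤ L ^ 6 * (L ^ (C' + C'' + 2)) ^ 2 := Nat.mul_le_mul h48 hsq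
      _ = (L ^ (C' + C'' + 5)) ^ 2 := by ring
  have hsqrt : (L ^ (C' + C'' + 5)) ^ 2 ≤ n := by
    have h := hn₂ n hn2
    rw [← hL] at h
    calc (L ^ (C' + C'' + 5)) ^ 2 ≤ (Nat.sqrt n) ^ 2 := Nat.pow_le_pow_left h 2
      _ ≤ n := Nat.sqrt_le' n
  unfold blocks
  omega

/-- monotonicity of the loss bound in `k`. -/
theorem lossBound_mono {n k k' : ℕ} (hk : k' ≤ k) (hn : 1 ≤ n) :
    (1 - 1 / (n : ℝ) ^ k') * (2 : ℝ) ^ n ≤ (1 - 1 / (n : ℝ) ^ k) * (2 : ℝ) ^ n := by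
  have hn' : (1 : ℝ) ≤ n := by exact_mod_cast hn
  have hpow : (n : ℝ) ^ k' ≤ (n : ℝ) ^ k := pow_le_pow_right₀ hn' hk
  have hpos : 0 < (n : ℝ) ^ k' := by positivity
  have hdiv : 1 / (n : ℝ) ^ k ≤ 1 / (n : ℝ) ^ k' := one_div_le_one_div_of_le hpos hpow
  have h2 : (0 : ℝ) ≤ 2 ^ n := by positivity
  exact mul_le_mul_of_nonneg_right (by linarith) h2

/-- **THE COLLAPSE, core (inline)**: «T on WILD strategies» gives «T on TAME strategies».  Given a tame polylog strategy `y`,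
`y ⊕ comb` has the same win set (the comb is exactly null), cut degree `+2`, and is WILD — else `μ_comb = μ_y ⊕ μ_{y⊕comb}`
would be polylog-degree and so would `PARITY_{⌊(n+1)/3⌋} = μ_comb ∘ sub`, contradicting `parity_not_hasDegF`. -/
theorem tame_of_wild
    (hW : ∀ (p : ℕ) [Fact p.Prime], 5 ≤ p → ∀ C : ℕ, ∃ C' k n₀ : ℕ, ∀ n ≥ n₀, ∀ c : ℕ,
      ∀ y : Fin (n + 1) → (Fin n → Bool) → Bool,
        (∀ g, HasDegF p (y g) ((Nat.log 2 n) ^ C)) →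
          ¬ HasDegF p (shotParity y) ((Nat.log 2 n) ^ C') →
            ((Finset.univ.filter fun u : Fin n → Bool => ringWinU c y u = true).card : ℝ) ≤
              (1 - 1 / (n : ℝ) ^ k) * (2 : ℝ) ^ n)
    (p : ℕ) [Fact p.Prime] (hp : 5 ≤ p) (C C' : ℕ) :
    ∃ k n₀ : ℕ, ∀ n ≥ n₀, ∀ c : ℕ, ∀ y : Fin (n + 1) → (Fin n → Bool) → Bool,
      (∀ g, HasDegF p (y g) ((Nat.log 2 n) ^ C)) →
        HasDegF p (shotParity y) ((Nat.log 2 n) ^ C') →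
          ((Finset.univ.filter fun u : Fin n → Bool => ringWinU c y u = true).card : ℝ) ≤
            (1 - 1 / (n : ℝ) ^ k) * (2 : ℝ) ^ n := by
  have hp2 : p ≠ 2 := by omega
  obtain ⟨C'', k, n₁, h₁⟩ := hW p hp (C + 2)
  obtain ⟨N, hN⟩ := budget C' C''
  refine ⟨k, max (max n₁ N) 4, fun n hn c y hy htame => ?_⟩
  have hn1 : n₁ ≤ n := le_trans (le_trans (le_max_left _ _) (le_max_left _ _)) hn
  have hnN : N ≤ n := le_trans (le_trans (le_max_right _ _) (le_max_left _ _)) hn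
  have hn4 : 4 ≤ n := le_trans (le_max_right _ _) hn
  have hL2 : 2 ≤ Nat.log 2 n := Nat.le_log_of_pow_le (by norm_num) (by omega)
  -- the twisted strategy
  set y' := RigidityLaws.xorStrat y (comb n) with hy'
  have hdeg' : ∀ g, HasDegF p (y' g) ((Nat.log 2 n) ^ (C + 2)) := by
    intro g
    have h := RigidityLaws.hasDegF_xorStrat hy (fun g => hasDegF_comb (p := p) g) g
    unfold HasDegF at h ⊢
    exact lowDeg_mono (pow_add_two_le hL2) h
  -- same win set
  have hwin : (Finset.univ.filter fun u : Fin n → Bool => ringWinU c y u = true) =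
      (Finset.univ.filter fun u : Fin n → Bool => ringWinU c y' u = true) := by
    apply Finset.filter_congr
    intro u _
    rw [hy', RigidityLaws.ringWinU_xorStrat, ringWinU_comb]
    simp
  -- y' is wild at exponent C''
  have hwild : ¬ HasDegF p (shotParity y') ((Nat.log 2 n) ^ C'') := by
    intro h'
    -- μ_comb = μ_y ⊕ μ_{y'} has degree L^C' + L^C''
    have hcomb : HasDegF p (shotParity (comb n)) ((Nat.log 2 n) ^ C' + (Nat.log 2 n) ^ C'') := by
      have h2 := tame_xorStrat htame h'
      rwa [hy', xorStrat_self_xorStrat] at h2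
    -- restrict along the substitution: PARITY_m has that degree
    have hpar : HasDegF p (parityFn (blocks n)) ((Nat.log 2 n) ^ C' + (Nat.log 2 n) ^ C'') := by
      unfold HasDegF at hcomb ⊢
      have hc := Summit.QuantumAdvantage.AdviceFreeQNC0.comp_mem_lowDeg_of_coord (F := ZMod p) (sub n)
        (sub_coord_mem_lowDeg p) hcomb
      have key : (fun v : Fin (blocks n) → Bool => if parityFn (blocks n) v = true then (1 : ZMod p) else 0) =
          fun v => (fun u : Fin n → Bool => if shotParity (comb n) u = true then (1 : ZMod p) else 0) (sub n v) := by
        funext v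
        simp only [shotParity_comb_sub]
      rw [key]
      exact hc
    exact parity_not_hasDegF hp2 (hN n hnN) hpar
  rw [hwin]
  exact h₁ n hn1 c y' hdeg' hwild

/-- **THE COLLAPSE (inline)**: «T restricted to WILD strategies» ⟺ T, where the right-hand side is VERBATIM the body of
`Theses.AbsorptionDial.WalkPolyLossOdd` (item stmt-QuantumAdvantage-26767, the conclusion of 28489 `MassHiQuarter`). -/
theorem wild_iff_polyLoss :
    (∀ (p : ℕ) [Fact p.Prime], 5 ≤ p → ∀ C : ℕ, ∃ C' k n₀ : ℕ, ∀ n ≥ n₀, ∀ c : ℕ,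
      ∀ y : Fin (n + 1) → (Fin n → Bool) → Bool,
        (∀ g, HasDegF p (y g) ((Nat.log 2 n) ^ C)) →
          ¬ HasDegF p (shotParity y) ((Nat.log 2 n) ^ C') →
            ((Finset.univ.filter fun u : Fin n → Bool => ringWinU c y u = true).card : ℝ) ≤
              (1 - 1 / (n : ℝ) ^ k) * (2 : ℝ) ^ n) ↔
    (∀ (p : ℕ) [Fact p.Prime], 5 ≤ p → ∀ C : ℕ, ∃ k n₀ : ℕ, ∀ n ≥ n₀, ∀ c : ℕ,
      ∀ y : Fin (n + 1) → (Fin n → Bool) → Bool,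
        (∀ g, HasDegF p (y g) ((Nat.log 2 n) ^ C)) →
          ((Finset.univ.filter fun u : Fin n → Bool => ringWinU c y u = true).card : ℝ) ≤
            (1 - 1 / (n : ℝ) ^ k) * (2 : ℝ) ^ n) := by
  constructor
  · intro hW p _ hp C
    obtain ⟨C', k₁, n₁, h₁⟩ := hW p hp C
    obtain ⟨k₂, n₂, h₂⟩ := tame_of_wild hW p hp C C'
    refine ⟨max k₁ k₂, max (max n₁ n₂) 1, fun n hn c y hy => ?_⟩
    have hn1 : n₁ ≤ n := le_trans (le_trans (le_max_left _ _) (le_max_left _ _)) hn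
    have hn2 : n₂ ≤ n := le_trans (le_trans (le_max_right _ _) (le_max_left _ _)) hn
    have hn0 : 1 ≤ n := le_trans (le_max_right _ _) hn
    by_cases htame : HasDegF p (shotParity y) ((Nat.log 2 n) ^ C')
    · exact (h₂ n hn2 c y hy htame).trans (lossBound_mono (le_max_right _ _) hn0)
    · exact (h₁ n hn1 c y hy htame).trans (lossBound_mono (le_max_left _ _) hn0)
  · intro hT p _ hp C
    obtain ⟨k, n₀, h⟩ := hT p hp C
    exact ⟨0, k, n₀, fun n hn c y hy _ => h n hn c y hy⟩

/-! ## §6 Why `p = 2` never sees the dial: there every strategy is tame -/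

/-- at `p = 2` XOR is free, so the shot parity of ANY strategy of cut degree `d` has degree `d`: the wild class is
EMPTY at `p = 2` (where T is α's theorem `walkHardF_two`); the dial — and its collapse — is an odd-`p` phenomenon. -/
theorem tame_two {d : ℕ} (y : Fin (n + 1) → (Fin n → Bool) → Bool) (hy : ∀ g, HasDegF 2 (y g) d) :
    HasDegF 2 (shotParity y) d := by
  have key : ∀ s : Finset (Fin (n + 1)),
      HasDegF 2 (fun u => decide ((s.filter fun g => y g u = true).card % 2 = 1)) d := by
    intro s
    induction s using Finset.induction_on with
    | empty =>
      simpa using RigidityLaws.hasDegF_const 2 false d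
    | insert a s ha ih =>
      have hstep : (fun u => decide (((insert a s).filter fun g => y g u = true).card % 2 = 1)) =
          fun u => xor (y a u) (decide ((s.filter fun g => y g u = true).card % 2 = 1)) := by
        funext u
        rw [filter_insert]
        cases h : y a u
        · simp
        · rw [if_pos rfl, card_insert_of_notMem (fun hm => ha (mem_filter.mp hm).1)]
          rcases Nat.mod_two_eq_zero_or_one ((s.filter fun g => y g u = true).card) with hk | hk <;>
            simp [Nat.add_mod, hk]
      rw [hstep]
      exact hasDeg_xor (hy a) ih
  exact key univ

end Summit.QuantumAdvantage.QuantumAdvantage.Theorems.TallyDial
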